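import Summits.BirchSwinnertonDyer.BirchSwinnertonDyer.Theorems.PrintCFramBottomClassIndexLawFiveLeHerbrandEigenspaceProjectors
import Mathlib.LinearAlgebra.Dual.Lemmas
import HarnessLib

/-!
# Crux `PrintCFram.BottomClassIndexLawFiveLe` (stmt-BirchSwinnertonDyer-20372), line `eisenstein-resource-bdp-line` (v10):
# Stub H, typing item T3/T4 adapter — `χ`-EQUIVARIANT LINEAR MAPS FACTOR THROUGH THE `χ`-PART
# («`Hom(X, 𝔽_p)^{[θ]} = 0 ⟺ X^{(θ)} = 0`» for `p ∤ |G|`)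

Cell `bsd-print-cfram`, width seat `bsd-line-cfram-p1-w4` (generation g5), `--supports stmt-BirchSwinnertonDyer-20372` (helper);
sixth file of the `HerbrandEigenspace*` series (w4 g4: Projectors / Decomposition / Induced / Devissage / Norm). THEOREMS ONLY,
Mathlib-level algebra in the series' definition-free currency (`ρ : Representation k G V`, `χ : G →* kˣ`, `χ`-part
`⨅ g, eigenspace (ρ g) (χ g)`, projector `e_χ = ⅟|G| • Σ_g χ(g⁻¹) • ρ g`); no definition, no named fact, no `sorry`.
BSD is not proved by any of this; no summit statement is proved by this seat; no stub is closed.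

WHY. The Selmer-side reduction `HerbrandSelmerToHom.datumStrictSelmer_bdpData_eq_bot_of_forall_hom_character` (this seat,
p648816 + companion) leaves Stub H as the vanishing of the `θ`-EQUIVARIANT continuous homomorphisms `f : Γ_L → 𝔽_p`,
`f(g n g⁻¹) = θ(g) f(n)`, with local conditions (M1 §2). Class field theory (T4) turns `Γ_L^{ab}` with its local
conditions into an idelic `G = Gal(L/K)`-module `X`; `f` becomes an `𝔽_p`-linear map `X/p → 𝔽_p` with
`f ∘ ρ(g) = θ(g) • f`. This file is the algebra that finishes: such an `f` FACTORS THROUGH THE PROJECTOR,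
`f = f ∘ e_θ` (`comp_proj_eq_self_of_equivariant`), so **`X^{(θ)} = 0 ⟹ f = 0`** (`eq_zero_of_equivariant_of_iInf_eigenspace_eq_bot`,
any commutative ring `k` with `|G| ∈ kˣ`, any target module) — and conversely over a field
(`iInf_eigenspace_eq_bot_iff_forall_dual_equivariant`): the `θ`-part of `X/p` that M1 §§3–6 bound by F1–F4 is EXACTLY
what controls the Hom-side. Also: `sum_apply_apply` / `proj_apply_apply` (`e_χ (ρ h v) = χ(h) • e_χ v`, the right-handed
companion of w4 g4's `apply_sum_apply`), `equivariant_comp_proj` (`f₀ ∘ e_χ` is `χ`-equivariant for every `f₀`),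
`apply_sub_smul_eq_zero_of_equivariant` (an equivariant map kills `(ρ g − χ g) v`).

References: Washington, *Introduction to Cyclotomic Fields* §6.3 (idempotents `ε_χ` for `p ∤ |G|`); Lang, *Cyclotomic Fields I–II*
Ch. 1 §3; the herbrand M1 memo §§2–3 (crux workfile).
-/

set_option linter.dupNamespace false
set_option autoImplicit false

open Module Module.End

namespace Summit.BirchSwinnertonDyer.BirchSwinnertonDyer.Theorems.PrintCFram.HerbrandEigenspace

section Equivariant

variable {k G V W : Type*} [CommRing k] [Group G] [AddCommGroup V] [Module k V] [AddCommGroup W] [Module k W]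
  (ρ : Representation k G V) (χ : G →* kˣ)

/-- A `χ`-equivariant linear map (`f (ρ g v) = χ(g) • f v`) kills every `ρ(g) v − χ(g) v`: it factors through the
`χ`-coinvariants. [cite: Washington1997, §6.3] [folklore] -/
theorem apply_sub_smul_eq_zero_of_equivariant (f : V →ₗ[k] W) (hf : ∀ (g : G) (v : V), f (ρ g v) = (χ g : k) • f v)
    (g : G) (v : V) : f (ρ g v - (χ g : k) • v) = 0 := by
  rw [map_sub, map_smul, hf, sub_self]

variable [Fintype G]

/-- **`S_χ ∘ ρ(h) = χ(h) • S_χ`** (reindex `g ↦ g h` in `Σ_g χ(g⁻¹) ρ(g h)`; no commutativity of `G` needed) — the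
right-handed companion of `apply_sum_apply`. [cite: Washington1997, §6.3] [folklore] -/
theorem sum_apply_apply (h : G) (v : V) :
    (∑ g : G, ((χ g⁻¹ : kˣ) : k) • ρ g) (ρ h v) = (χ h : k) • (∑ g : G, ((χ g⁻¹ : kˣ) : k) • ρ g) v := by
  simp only [LinearMap.sum_apply, LinearMap.smul_apply]
  calc ∑ g : G, ((χ g⁻¹ : kˣ) : k) • ρ g (ρ h v)
      = ∑ g : G, ((χ (h * (g * h)⁻¹) : kˣ) : k) • ρ (g * h) v := by
        refine Finset.sum_congr rfl fun g _ => ?_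
        rw [map_mul ρ, Module.End.mul_apply, mul_inv_rev, mul_inv_cancel_left]
    _ = ∑ g : G, ((χ (h * g⁻¹) : kˣ) : k) • ρ g v :=
        Fintype.sum_bijective (fun g => g * h) (Group.mulRight_bijective h) _
          (fun g => ((χ (h * g⁻¹) : kˣ) : k) • ρ g v) fun _ => rfl
    _ = (χ h : k) • ∑ g : G, ((χ g⁻¹ : kˣ) : k) • ρ g v := by
        rw [Finset.smul_sum]
        refine Finset.sum_congr rfl fun g _ => ?_
        rw [map_mul, Units.val_mul, mul_smul]

variable [Invertible (Fintype.card G : k)]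

/-- **`e_χ (ρ h v) = χ(h) • e_χ v`.** [cite: Washington1997, §6.3] [folklore] -/
theorem proj_apply_apply (h : G) (v : V) :
    (⅟(Fintype.card G : k) • ∑ g : G, ((χ g⁻¹ : kˣ) : k) • ρ g) (ρ h v) =
      (χ h : k) • (⅟(Fintype.card G : k) • ∑ g : G, ((χ g⁻¹ : kˣ) : k) • ρ g) v := by
  rw [LinearMap.smul_apply, LinearMap.smul_apply, sum_apply_apply ρ χ h v, smul_comm]

/-- **Every `f₀ ∘ e_χ` is `χ`-equivariant.** [cite: Washington1997, §6.3] [folklore] -/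
theorem equivariant_comp_proj (f₀ : V →ₗ[k] W) (g : G) (v : V) :
    (f₀ ∘ₗ (⅟(Fintype.card G : k) • ∑ g : G, ((χ g⁻¹ : kˣ) : k) • ρ g)) (ρ g v) =
      (χ g : k) • (f₀ ∘ₗ (⅟(Fintype.card G : k) • ∑ g : G, ((χ g⁻¹ : kˣ) : k) • ρ g)) v := by
  rw [LinearMap.comp_apply, LinearMap.comp_apply, proj_apply_apply ρ χ g v, map_smul]

/-- **A `χ`-equivariant linear map factors through the projector: `f (e_χ v) = f v`** —
`f(e_χ v) = ⅟|G| Σ_g χ(g⁻¹) f(ρ g v) = ⅟|G| Σ_g χ(g⁻¹) χ(g) f v = f v`. [cite: Washington1997, §6.3] [folklore] -/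
theorem apply_proj_eq_of_equivariant (f : V →ₗ[k] W) (hf : ∀ (g : G) (v : V), f (ρ g v) = (χ g : k) • f v) (v : V) :
    f ((⅟(Fintype.card G : k) • ∑ g : G, ((χ g⁻¹ : kˣ) : k) • ρ g) v) = f v := by
  rw [proj_apply ρ χ v, map_smul, map_sum]
  have e : ∀ g : G, f (((χ g⁻¹ : kˣ) : k) • ρ g v) = f v := fun g => by
    rw [map_smul, hf, smul_smul, ← Units.val_mul, ← map_mul, inv_mul_cancel, map_one, Units.val_one, one_smul]
  simp_rw [e]
  rw [Finset.sum_const, Finset.card_univ, ← Nat.cast_smul_eq_nsmul k, smul_smul, invOf_mul_self, one_smul]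

/-- The same as an identity of linear maps: `f ∘ e_χ = f`. [cite: Washington1997, §6.3] [folklore] -/
theorem comp_proj_eq_self_of_equivariant (f : V →ₗ[k] W) (hf : ∀ (g : G) (v : V), f (ρ g v) = (χ g : k) • f v) :
    f ∘ₗ (⅟(Fintype.card G : k) • ∑ g : G, ((χ g⁻¹ : kˣ) : k) • ρ g) = f :=
  LinearMap.ext fun v => apply_proj_eq_of_equivariant ρ χ f hf v

/-- A `χ`-equivariant linear map is determined by its restriction to the `χ`-part: it kills `ker e_χ` (the complement
`⊕_{ψ ≠ χ} V^{(ψ)}`). [cite: Washington1997, §6.3] [folklore] -/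
theorem ker_proj_le_ker_of_equivariant (f : V →ₗ[k] W) (hf : ∀ (g : G) (v : V), f (ρ g v) = (χ g : k) • f v) :
    LinearMap.ker (⅟(Fintype.card G : k) • ∑ g : G, ((χ g⁻¹ : kˣ) : k) • ρ g) ≤ LinearMap.ker f := by
  intro v hv
  rw [LinearMap.mem_ker] at hv ⊢
  rw [← apply_proj_eq_of_equivariant ρ χ f hf v, hv, map_zero]

/-- **`V^{(χ)} = 0 ⟹ every `χ`-equivariant linear map out of `V` vanishes`** (any commutative ring `k` with `|G| ∈ kˣ`,
any target): `f = f ∘ e_χ` and `e_χ = 0`. This is the direction Stub H's Hom-side needs: the `θ`-equivariant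
homomorphisms `Γ_L^{ab}/p → 𝔽_p` vanish once the `θ`-part of the idelic module does (M1 §3, (M1≤)).
[cite: Washington1997, §6.3] [folklore] -/
theorem eq_zero_of_equivariant_of_iInf_eigenspace_eq_bot (hbot : (⨅ g : G, eigenspace (ρ g) (χ g : k)) = ⊥)
    (f : V →ₗ[k] W) (hf : ∀ (g : G) (v : V), f (ρ g v) = (χ g : k) • f v) : f = 0 := by
  rw [← comp_proj_eq_self_of_equivariant ρ χ f hf, (iInf_eigenspace_eq_bot_iff ρ χ).1 hbot, LinearMap.comp_zero]

/-- Pointwise form: `V^{(χ)} = 0`, `f` `χ`-equivariant ⟹ `f v = 0`. [cite: Washington1997, §6.3] [folklore] -/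
theorem apply_eq_zero_of_equivariant_of_iInf_eigenspace_eq_bot (hbot : (⨅ g : G, eigenspace (ρ g) (χ g : k)) = ⊥)
    (f : V →ₗ[k] W) (hf : ∀ (g : G) (v : V), f (ρ g v) = (χ g : k) • f v) (v : V) : f v = 0 := by
  rw [eq_zero_of_equivariant_of_iInf_eigenspace_eq_bot ρ χ hbot f hf, LinearMap.zero_apply]

/-- A non-zero `χ`-equivariant map detects the `χ`-part: if `f (e_χ v) ≠ 0` for some `v` … conversely, a vector of the
`χ`-part on which some linear map `f₀` is non-zero yields a NON-ZERO `χ`-equivariant map `f₀ ∘ e_χ`.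
[cite: Washington1997, §6.3] [folklore] -/
theorem comp_proj_apply_eq_of_mem (f₀ : V →ₗ[k] W) {v : V} (hv : v ∈ ⨅ g : G, eigenspace (ρ g) (χ g : k)) :
    (f₀ ∘ₗ (⅟(Fintype.card G : k) • ∑ g : G, ((χ g⁻¹ : kˣ) : k) • ρ g)) v = f₀ v := by
  rw [LinearMap.comp_apply, proj_eq_self ρ χ hv]

end Equivariant

section Field

variable {k G V : Type*} [Field k] [Group G] [Fintype G] [AddCommGroup V] [Module k V]
  [Invertible (Fintype.card G : k)] (ρ : Representation k G V) (χ : G →* kˣ)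

/-- **`V^{(χ)} = 0 ⟺ every `χ`-equivariant linear functional vanishes`** (over a field, where functionals separate
points: `Module.forall_dual_apply_eq_zero_iff`). «`Hom(X, 𝔽_p)^{[θ]} = 0 ⟺ X^{(θ)} = 0`» for `p ∤ |G|`.
[cite: Washington1997, §6.3] [folklore] -/
theorem iInf_eigenspace_eq_bot_iff_forall_dual_equivariant :
    (⨅ g : G, eigenspace (ρ g) (χ g : k)) = ⊥ ↔
      ∀ f : Module.Dual k V, (∀ (g : G) (v : V), f (ρ g v) = (χ g : k) • f v) → f = 0 := by
  refine ⟨fun hbot f hf => eq_zero_of_equivariant_of_iInf_eigenspace_eq_bot ρ χ hbot f hf, fun h => ?_⟩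
  rw [Submodule.eq_bot_iff]
  intro v hv
  refine (Module.forall_dual_apply_eq_zero_iff k v).1 fun f₀ => ?_
  have hf := h (f₀ ∘ₗ (⅟(Fintype.card G : k) • ∑ g : G, ((χ g⁻¹ : kˣ) : k) • ρ g)) (equivariant_comp_proj ρ χ f₀)
  rw [← comp_proj_apply_eq_of_mem ρ χ f₀ hv, hf, LinearMap.zero_apply]

/-- Contrapositive reading: a non-zero vector of the `χ`-part is seen by some `χ`-equivariant functional.
[cite: Washington1997, §6.3] [folklore] -/
theorem exists_dual_equivariant_apply_ne_zero {v : V} (hv : v ∈ ⨅ g : G, eigenspace (ρ g) (χ g : k)) (hv0 : v ≠ 0) :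
    ∃ f : Module.Dual k V, (∀ (g : G) (w : V), f (ρ g w) = (χ g : k) • f w) ∧ f v ≠ 0 := by
  obtain ⟨f₀, hf₀⟩ : ∃ f₀ : Module.Dual k V, f₀ v ≠ 0 :=
    not_forall.mp (mt (Module.forall_dual_apply_eq_zero_iff k v).1 hv0)
  exact ⟨f₀ ∘ₗ (⅟(Fintype.card G : k) • ∑ g : G, ((χ g⁻¹ : kˣ) : k) • ρ g), equivariant_comp_proj ρ χ f₀,
    by rwa [comp_proj_apply_eq_of_mem ρ χ f₀ hv]⟩

end Field

end Summit.BirchSwinnertonDyer.BirchSwinnertonDyer.Theorems.PrintCFram.HerbrandEigenspace
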